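import Summits.QuantumFields.BalabanUV.Beta.EriceRemainderEnclosureHistoryAutonomyComparisonFourAgesPolys
import Summits.QuantumFields.BalabanUV.Beta.EriceRemainderEnclosureHistoryAutonomyComparisonTowerRatioFourStep

/-!
# EriceRemainderEnclosureHistoryAutonomyComparisonFourAgesSteps — (E68b) THE THREE FREE STEPS OF A FOUR-AGE SET: (i) **`first_step_tight`** — from the exact
# youngest state a step of ANY ratio `r ∈ ]0,1]` lands in the TIGHT region `λ ≤ H₁(Z) = (11∕10)Z∕(1 − (9∕10)Z)` ((E67a) landed in `4Z∕(2 − Z)`, which a second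
# free step does not survive); (ii) **`middle_step_free`** — from `λ ≤ H₁(Z)` a step of ANY ratio lands in `λ ≤ H₂(Z) = (13∕10)Z∕(1 − (23∕20)Z)` with the
# chain condition; (iii) **`last_step_from_H2`** — from `λ ≤ H₂(Z)` the chain condition holds at a last step of ANY ratio.  All under the crude line
# `x√(1∕2) + y√(r∕(1+r)) ≤ 1∕2` ((E67b) `crude_line_at`), by 4–5 ratio cells each ((E68a)).  With (E68c)∕(E68d): EVERY SET OF AT MOST FOUR AGES COMPARES

Cell `pub-balaban`, β-function sub-cell, BINDER row D4 «RemainderConst leaves for Bałaban's split» (`HOME/BINDER-OWNERS.md`; owner lineage `b2b-balaban-beta-an4`;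
this file by co-owner #2 lineage `b2b-balaban-beta-d4-p2`, generation 59), β-FLOW TEAM duty (1), FREEZE (0) honoured (def-free; (E68a) cells, (E67a)
`le_sqrt_ratio`, (E67c) `sum_le_of_crude_line` BY NAME).

HONEST FRAMING (page 1, verbatim and binding).  *"Discharging BetaPertH makes Bałaban's UV stability UNCONDITIONAL — a real constructive-QFT result; it is
NOT the continuum limit and NOT the Clay problem."*  THIS FILE DISCHARGES NOTHING OF THE KIND.  Lemmas about a few non-negative reals; nothing of Bałaban's is
asserted.  Row D4 class UNCHANGED (critical-path width 0; instance 0∕1; D4 DISCHARGE NO DATE).  HONEST DEPENDENCY: continuum YM on T⁴ ⇐ BetaPertH ∧ nine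
spine estimates (0/9 proved); BetaPertH ⇐ (D1) ∧ (D4) ∧ CAP+tail; G-an2-4 gates asym, D1 and NE2/3/4.

THE POINT (census sense (α); the COMPARISON column, conjecture (E58′)).  Numerics (README `g59/e66`, `fourages.py`, `four2–4.py`): with all steps free the
envelopes after one and two steps stay bounded and the third condition is `≤ 0.69`; a FIFTH age breaks this relaxation (condition `1.13`).  NOT CLAIMED: five
ages; anything printed.

WHAT IS PROVED ([folklore]; 0 `def`, 0 sorry).  `hyperbola_mono_gen`, `first_cell`, `mid_cell`, `last_cell`, **`first_step_tight`**, **`middle_step_free`**,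
**`last_step_from_H2`**.
-/
noncomputable section

namespace Summit.QuantumFields.BalabanUV.Beta.EriceRemainderEnclosureHistoryAutonomyComparisonFourAgesSteps

open Summit.QuantumFields.BalabanUV.Beta.EriceRemainderEnclosureHistoryAutonomyComparisonFourAgesPolys
open Summit.QuantumFields.BalabanUV.Beta.EriceRemainderEnclosureHistoryAutonomyComparisonTowerFreeSteps (le_sqrt_ratio)
open Summit.QuantumFields.BalabanUV.Beta.EriceRemainderEnclosureHistoryAutonomyComparisonTowerRatioFourStep (sum_le_of_crude_line)

/-! ## §1 Generic cells -/

/-- `Z ↦ cZ∕(1 − αZ)` is monotone below the pole (`c, α ≥ 0`). [folklore] -/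
theorem hyperbola_mono_gen {c α a b : ℝ} (hc : 0 ≤ c) (hα : 0 ≤ α) (hab : a ≤ b) (hb : α * b < 1) :
    c * a / (1 - α * a) ≤ c * b / (1 - α * b) := by
  have h1 : 0 < 1 - α * b := by linarith
  have h2 : 0 < 1 - α * a := by nlinarith [mul_le_mul_of_nonneg_left hab hα]
  rw [div_le_div_iff₀ h2 h1]; nlinarith [mul_nonneg hc (sub_nonneg.mpr hab), mul_nonneg hc hα]

/-- `70∕99 ≤ √(1∕2)` and the rational form of the crude line. -/
theorem line_rat {x y r C : ℝ} (hx : 0 ≤ x) (hy : 0 ≤ y) (hr0 : 0 ≤ r) (hC : 0 ≤ C) (hCr : C ^ 2 * (1 + r) ≤ r)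
    (hb : x * Real.sqrt (1 / 2) + y * Real.sqrt (r / (1 + r)) ≤ 1 / 2) : 70 / 99 * x + C * y ≤ 1 / 2 := by
  have h70 : (70 : ℝ) / 99 ≤ Real.sqrt (1 / 2) := by
    rw [show (70 : ℝ) / 99 = Real.sqrt ((70 / 99) ^ 2) by rw [Real.sqrt_sq (by norm_num)]]
    exact Real.sqrt_le_sqrt (by norm_num)
  have hcred : C ≤ Real.sqrt (r / (1 + r)) := le_sqrt_ratio hC hr0 hCr
  have h1 : 70 / 99 * x ≤ x * Real.sqrt (1 / 2) := by rw [mul_comm]; exact mul_le_mul_of_nonneg_left h70 hx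
  have h2 : C * y ≤ y * Real.sqrt (r / (1 + r)) := by rw [mul_comm]; exact mul_le_mul_of_nonneg_left hcred hy
  linarith

set_option maxHeartbeats 400000 in
/-- **FIRST CELL**: the tight first landing from the data of one ratio cell (`S ≤ √r`, `C ≤ √(r∕(1+r))`, `e ≤ E·σ₀`) and the two cell inequalities. -/
theorem first_cell {x y r e S C E : ℝ} (hx : 0 ≤ x) (hy : 0 ≤ y) (hy1 : y ≤ 71 / 100) (hr0 : 0 ≤ r) (hr1 : r ≤ 1)
    (hS : 0 ≤ S) (hSr : S ^ 2 ≤ r) (hC : 0 ≤ C) (hCr : C ^ 2 * (1 + r) ≤ r) (heE : e ≤ E * (y / (1 - 3 / 4 * y)))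
    (hb : x * Real.sqrt (1 / 2) + y * Real.sqrt (r / (1 + r)) ≤ 1 / 2)
    (hpoly : 70 / 99 * x + C * y ≤ 1 / 2 →
      (y * r * (1 + x / 4) + x * ((1 - 3 / 4 * y) + E * y)) * (1 - 9 / 10 * (x + S * y)) ≤
        11 / 10 * (x + S * y) * ((1 - 3 / 4 * y) * (1 - 3 / 4 * x) - E * y * x))
    (hcond : 70 / 99 * x + C * y ≤ 1 / 2 → x * (3 / 4 * (1 - 3 / 4 * y) + E * y) ≤ 99 / 100 * (1 - 3 / 4 * y)) :
    x * (e + 3 / 4) < 1 ∧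
    y / (1 - 3 / 4 * y) * r * (1 + x / 4) + x * (1 + e) ≤
      11 / 10 * (x + Real.sqrt r * y) / (1 - 9 / 10 * (x + Real.sqrt r * y)) * (1 - x * (3 / 4 + e)) := by
  have hbl := line_rat hx hy hr0 hC hCr hb
  have hP := hpoly hbl
  have hCd := hcond hbl
  have hden : 0 < 1 - 3 / 4 * y := by linarith
  obtain ⟨σ, hσ_def⟩ : ∃ σ : ℝ, σ = y / (1 - 3 / 4 * y) := ⟨_, rfl⟩
  have hσ0 : 0 ≤ σ := by rw [hσ_def]; exact div_nonneg hy hden.le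
  have hσy : σ * (1 - 3 / 4 * y) = y := by rw [hσ_def, div_mul_cancel₀ _ hden.ne']
  rw [← hσ_def] at heE ⊢
  -- condition
  have hcondE : x * (3 / 4 + E * σ) ≤ 99 / 100 := by
    have e1 : x * (3 / 4 + E * σ) * (1 - 3 / 4 * y) = x * (3 / 4 * (1 - 3 / 4 * y) + E * y) := by
      linear_combination (E * x) * hσy
    have h1 : x * (3 / 4 + E * σ) * (1 - 3 / 4 * y) ≤ 99 / 100 * (1 - 3 / 4 * y) := by rw [e1]; exact hCd
    exact le_of_mul_le_mul_right h1 hden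
  have hxe : x * e ≤ x * (E * σ) := mul_le_mul_of_nonneg_left heE hx
  refine ⟨by nlinarith, ?_⟩
  -- sum bound and positivity of the H₁ denominators
  have hZ := sum_le_of_crude_line hx hy hr0 hr1 hb
  have hsq : S ≤ Real.sqrt r := by
    rw [show S = Real.sqrt (S ^ 2) by rw [Real.sqrt_sq hS]]; exact Real.sqrt_le_sqrt hSr
  have hSy : x + S * y ≤ x + Real.sqrt r * y := by nlinarith [mul_le_mul_of_nonneg_right hsq hy]
  have hd2 : 0 < 1 - 9 / 10 * (x + S * y) := by nlinarith [mul_nonneg hS hy]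
  -- the cell inequality in σ-form
  have hPσ : (σ * r * (1 + x / 4) + x * (1 + E * σ)) * (1 - 9 / 10 * (x + S * y)) ≤ 11 / 10 * (x + S * y) * (1 - x * (3 / 4 + E * σ)) := by
    have e1 : (σ * r * (1 + x / 4) + x * (1 + E * σ)) * (1 - 9 / 10 * (x + S * y)) * (1 - 3 / 4 * y) =
        (y * r * (1 + x / 4) + x * ((1 - 3 / 4 * y) + E * y)) * (1 - 9 / 10 * (x + S * y)) := by
      linear_combination ((r * (1 + x / 4) + x * E) * (1 - 9 / 10 * (x + S * y))) * hσy
    have e2 : 11 / 10 * (x + S * y) * (1 - x * (3 / 4 + E * σ)) * (1 - 3 / 4 * y) =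
        11 / 10 * (x + S * y) * ((1 - 3 / 4 * y) * (1 - 3 / 4 * x) - E * y * x) := by
      linear_combination (-(11 / 10) * (x + S * y) * x * E) * hσy
    have := hP
    rw [← e1, ← e2] at this
    exact le_of_mul_le_mul_right this hden
  have hfac0 : 0 ≤ 1 - x * (3 / 4 + E * σ) := by linarith
  have hfac1 : 1 - x * (3 / 4 + E * σ) ≤ 1 - x * (3 / 4 + e) := by linarith
  have hF0 : 0 ≤ 11 / 10 * (x + Real.sqrt r * y) / (1 - 9 / 10 * (x + Real.sqrt r * y)) :=
    div_nonneg (by positivity) (by linarith)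
  have hmono : 11 / 10 * (x + S * y) / (1 - 9 / 10 * (x + S * y)) ≤ 11 / 10 * (x + Real.sqrt r * y) / (1 - 9 / 10 * (x + Real.sqrt r * y)) :=
    hyperbola_mono_gen (by norm_num) (by norm_num) hSy (by linarith)
  calc σ * r * (1 + x / 4) + x * (1 + e)
      ≤ σ * r * (1 + x / 4) + x * (1 + E * σ) := by linarith
    _ ≤ 11 / 10 * (x + S * y) / (1 - 9 / 10 * (x + S * y)) * (1 - x * (3 / 4 + E * σ)) := by
        rw [div_mul_eq_mul_div, le_div_iff₀ hd2]; linarith [hPσ]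
    _ ≤ 11 / 10 * (x + Real.sqrt r * y) / (1 - 9 / 10 * (x + Real.sqrt r * y)) * (1 - x * (3 / 4 + E * σ)) :=
        mul_le_mul_of_nonneg_right hmono hfac0
    _ ≤ _ := mul_le_mul_of_nonneg_left hfac1 hF0

set_option maxHeartbeats 400000 in
/-- **MIDDLE CELL**: from `λ ≤ H₁(y)` (`y` = the predecessor's young pressure) the landing in `H₂` and the condition, from one cell's data and inequalities. -/
theorem mid_cell {x y r lam S C : ℝ} (hx : 0 ≤ x) (hy : 0 ≤ y) (hy1 : y ≤ 71 / 100) (hr0 : 0 ≤ r) (hr1 : r ≤ 1)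
    (hS : 0 ≤ S) (hSr : S ^ 2 ≤ r) (hC : 0 ≤ C) (hCr : C ^ 2 * (1 + r) ≤ r)
    (hlam : lam ≤ 11 / 10 * y / (1 - 9 / 10 * y))
    (hb : x * Real.sqrt (1 / 2) + y * Real.sqrt (r / (1 + r)) ≤ 1 / 2)
    (hpoly : 70 / 99 * x + C * y ≤ 1 / 2 →
      (11 / 10 * y * r * (1 + x / 4) + x * ((1 - 9 / 10 * y) + 2 * r * (11 / 10) * y)) * (1 - 23 / 20 * (x + S * y)) ≤
        13 / 10 * (x + S * y) * ((1 - 9 / 10 * y) * (1 - 3 / 4 * x) - 2 * r * (11 / 10) * y * x))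
    (hcond : 70 / 99 * x + C * y ≤ 1 / 2 → x * (3 / 4 * (1 - 9 / 10 * y) + 2 * r * (11 / 10) * y) ≤ 99 / 100 * (1 - 9 / 10 * y)) :
    x * (2 * r * lam + 3 / 4) < 1 ∧
    lam * r * (1 + x / 4) + x * (1 + 2 * r * lam) ≤
      13 / 10 * (x + Real.sqrt r * y) / (1 - 23 / 20 * (x + Real.sqrt r * y)) * (1 - x * (3 / 4 + 2 * r * lam)) := by
  have hbl := line_rat hx hy hr0 hC hCr hb
  have hP := hpoly hbl
  have hCd := hcond hbl
  have hden : 0 < 1 - 9 / 10 * y := by linarith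
  obtain ⟨η, hη_def⟩ : ∃ η : ℝ, η = 11 / 10 * y / (1 - 9 / 10 * y) := ⟨_, rfl⟩
  have hη0 : 0 ≤ η := by rw [hη_def]; exact div_nonneg (by linarith) hden.le
  have hηy : η * (1 - 9 / 10 * y) = 11 / 10 * y := by rw [hη_def, div_mul_cancel₀ _ hden.ne']
  rw [← hη_def] at hlam
  have hcondη : x * (3 / 4 + 2 * r * η) ≤ 99 / 100 := by
    have e1 : x * (3 / 4 + 2 * r * η) * (1 - 9 / 10 * y) = x * (3 / 4 * (1 - 9 / 10 * y) + 2 * r * (11 / 10) * y) := by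
      linear_combination (2 * r * x) * hηy
    have h1 : x * (3 / 4 + 2 * r * η) * (1 - 9 / 10 * y) ≤ 99 / 100 * (1 - 9 / 10 * y) := by rw [e1]; exact hCd
    exact le_of_mul_le_mul_right h1 hden
  have hrl : 2 * r * lam ≤ 2 * r * η := mul_le_mul_of_nonneg_left hlam (by linarith)
  have hxe : x * (2 * r * lam) ≤ x * (2 * r * η) := mul_le_mul_of_nonneg_left hrl hx
  refine ⟨by nlinarith, ?_⟩
  have hZ := sum_le_of_crude_line hx hy hr0 hr1 hb
  have hsq : S ≤ Real.sqrt r := by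
    rw [show S = Real.sqrt (S ^ 2) by rw [Real.sqrt_sq hS]]; exact Real.sqrt_le_sqrt hSr
  have hSy : x + S * y ≤ x + Real.sqrt r * y := by nlinarith [mul_le_mul_of_nonneg_right hsq hy]
  have hd2 : 0 < 1 - 23 / 20 * (x + S * y) := by nlinarith [mul_nonneg hS hy]
  have hPη : (η * r * (1 + x / 4) + x * (1 + 2 * r * η)) * (1 - 23 / 20 * (x + S * y)) ≤ 13 / 10 * (x + S * y) * (1 - x * (3 / 4 + 2 * r * η)) := by
    have e1 : (η * r * (1 + x / 4) + x * (1 + 2 * r * η)) * (1 - 23 / 20 * (x + S * y)) * (1 - 9 / 10 * y) =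
        (11 / 10 * y * r * (1 + x / 4) + x * ((1 - 9 / 10 * y) + 2 * r * (11 / 10) * y)) * (1 - 23 / 20 * (x + S * y)) := by
      linear_combination ((r * (1 + x / 4) + 2 * r * x) * (1 - 23 / 20 * (x + S * y))) * hηy
    have e2 : 13 / 10 * (x + S * y) * (1 - x * (3 / 4 + 2 * r * η)) * (1 - 9 / 10 * y) =
        13 / 10 * (x + S * y) * ((1 - 9 / 10 * y) * (1 - 3 / 4 * x) - 2 * r * (11 / 10) * y * x) := by
      linear_combination (-(13 / 10) * (x + S * y) * x * 2 * r) * hηy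
    have := hP
    rw [← e1, ← e2] at this
    exact le_of_mul_le_mul_right this hden
  have hfac0 : 0 ≤ 1 - x * (3 / 4 + 2 * r * η) := by linarith
  have hfac1 : 1 - x * (3 / 4 + 2 * r * η) ≤ 1 - x * (3 / 4 + 2 * r * lam) := by linarith
  have hF0 : 0 ≤ 13 / 10 * (x + Real.sqrt r * y) / (1 - 23 / 20 * (x + Real.sqrt r * y)) :=
    div_nonneg (by positivity) (by linarith)
  have hmono : 13 / 10 * (x + S * y) / (1 - 23 / 20 * (x + S * y)) ≤ 13 / 10 * (x + Real.sqrt r * y) / (1 - 23 / 20 * (x + Real.sqrt r * y)) :=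
    hyperbola_mono_gen (by norm_num) (by norm_num) hSy (by linarith)
  have ht : lam * r * (1 + x / 4) ≤ η * r * (1 + x / 4) :=
    mul_le_mul_of_nonneg_right (mul_le_mul_of_nonneg_right hlam hr0) (by linarith)
  calc lam * r * (1 + x / 4) + x * (1 + 2 * r * lam)
      ≤ η * r * (1 + x / 4) + x * (1 + 2 * r * η) := by linarith
    _ ≤ 13 / 10 * (x + S * y) / (1 - 23 / 20 * (x + S * y)) * (1 - x * (3 / 4 + 2 * r * η)) := by
        rw [div_mul_eq_mul_div, le_div_iff₀ hd2]; linarith [hPη]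
    _ ≤ 13 / 10 * (x + Real.sqrt r * y) / (1 - 23 / 20 * (x + Real.sqrt r * y)) * (1 - x * (3 / 4 + 2 * r * η)) :=
        mul_le_mul_of_nonneg_right hmono hfac0
    _ ≤ _ := mul_le_mul_of_nonneg_left hfac1 hF0

/-- **LAST CELL**: from `λ ≤ H₂(y)` the condition, from one cell's data and inequality. -/
theorem last_cell {x y r lam C : ℝ} (hx : 0 ≤ x) (hy : 0 ≤ y) (hy1 : y ≤ 71 / 100) (hr0 : 0 ≤ r)
    (hC : 0 ≤ C) (hCr : C ^ 2 * (1 + r) ≤ r) (hlam : lam ≤ 13 / 10 * y / (1 - 23 / 20 * y))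
    (hb : x * Real.sqrt (1 / 2) + y * Real.sqrt (r / (1 + r)) ≤ 1 / 2)
    (hcond : 70 / 99 * x + C * y ≤ 1 / 2 → x * (3 / 4 * (1 - 23 / 20 * y) + 2 * r * (13 / 10) * y) ≤ 99 / 100 * (1 - 23 / 20 * y)) :
    x * (3 / 4 + 2 * r * lam) < 1 := by
  have hbl := line_rat hx hy hr0 hC hCr hb
  have hCd := hcond hbl
  have hden : 0 < 1 - 23 / 20 * y := by linarith
  obtain ⟨η, hη_def⟩ : ∃ η : ℝ, η = 13 / 10 * y / (1 - 23 / 20 * y) := ⟨_, rfl⟩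
  have hηy : η * (1 - 23 / 20 * y) = 13 / 10 * y := by rw [hη_def, div_mul_cancel₀ _ hden.ne']
  rw [← hη_def] at hlam
  have hcondη : x * (3 / 4 + 2 * r * η) ≤ 99 / 100 := by
    have e1 : x * (3 / 4 + 2 * r * η) * (1 - 23 / 20 * y) = x * (3 / 4 * (1 - 23 / 20 * y) + 2 * r * (13 / 10) * y) := by
      linear_combination (2 * r * x) * hηy
    have h1 : x * (3 / 4 + 2 * r * η) * (1 - 23 / 20 * y) ≤ 99 / 100 * (1 - 23 / 20 * y) := by rw [e1]; exact hCd
    exact le_of_mul_le_mul_right h1 hden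
  have hxe : x * (2 * r * lam) ≤ x * (2 * r * η) := mul_le_mul_of_nonneg_left (mul_le_mul_of_nonneg_left hlam (by linarith)) hx
  nlinarith

/-! ## §2 The three free steps, every ratio -/

set_option maxHeartbeats 800000 in
/-- **THE FREE FIRST STEP WITH THE TIGHT LANDING.**  Exact youngest state (`y ∈ [0, 71∕100]`, `σ₀ = y∕(1 − 3y∕4)`), ANY ratio `r ∈ ]0,1]`, load `x ≥ 0` under the
crude line, defect bound `0 ≤ e ≤ min(2rσ₀, 3rσ₀∕(1+r)²)` (both transports of (E65e)): the condition `x(e + 3∕4) < 1` and the landing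
`σ₀r(1 + x∕4) + x(1 + e) ≤ H₁(x + √r·y)(1 − x(3∕4 + e))`, `H₁(Z) = (11∕10)Z∕(1 − (9∕10)Z)`. [folklore] -/
theorem first_step_tight {x y r e : ℝ} (hx : 0 ≤ x) (hy : 0 ≤ y) (hy1 : y ≤ 71 / 100) (hr0 : 0 < r) (hr1 : r ≤ 1)
    (he1 : e ≤ 2 * r * (y / (1 - 3 / 4 * y))) (he2 : e ≤ 3 * r / (1 + r) ^ 2 * (y / (1 - 3 / 4 * y)))
    (hb : x * Real.sqrt (1 / 2) + y * Real.sqrt (r / (1 + r)) ≤ 1 / 2) :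
    x * (e + 3 / 4) < 1 ∧
    y / (1 - 3 / 4 * y) * r * (1 + x / 4) + x * (1 + e) ≤
      11 / 10 * (x + Real.sqrt r * y) / (1 - 9 / 10 * (x + Real.sqrt r * y)) * (1 - x * (3 / 4 + e)) := by
  have hσ0 : 0 ≤ y / (1 - 3 / 4 * y) := div_nonneg hy (by linarith)
  have hr0' := hr0.le
  rcases le_or_gt r (1 / 16) with h1 | h1
  · exact first_cell (S := 0 + 4 * r) (C := 0 + 97 / 25 * r) (E := 2 * r) hx hy hy1 hr0' hr1
      (by linarith) (by nlinarith) (by linarith) (by nlinarith [mul_nonneg hr0' (sub_nonneg.mpr h1)])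
      (he1.trans (le_of_eq (by ring))) hb
      (fun h => first4_poly_1 hx hr0' h1 h hy hy1) (fun h => first4_cond_1 hx hr0' h1 h hy hy1)
  rcases le_or_gt r (1 / 4) with h2 | h2
  · exact first_cell (S := 2667 / 16000 + 1333 / 1000 * r) (C := 2781 / 16000 + 1091 / 1000 * r) (E := 2 * r) hx hy hy1 hr0' hr1
      (by linarith) (by nlinarith [mul_nonneg (sub_nonneg.mpr h1.le) (sub_nonneg.mpr h2)]) (by linarith)
      (by nlinarith [mul_nonneg (sub_nonneg.mpr h1.le) (sub_nonneg.mpr h2), mul_nonneg (mul_nonneg (sub_nonneg.mpr h1.le) (sub_nonneg.mpr h2)) hr0'])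
      (he1.trans (le_of_eq (by ring))) hb
      (fun h => first4_poly_2 hx h1.le h2 h hy hy1) (fun h => first4_cond_2 hx h1.le h2 h hy hy1)
  rcases le_or_gt r (1 / 2) with h3 | h3
  · have hE : 3 * r / (1 + r) ^ 2 ≤ 3247 / 10000 + 361 / 500 * r := by
      rw [div_le_iff₀ (by positivity)]
      nlinarith [sq_nonneg (r - 3 / 8), mul_nonneg (sq_nonneg (r - 3 / 8)) hr0', sq_nonneg (r - 37 / 100)]
    exact first_cell (S := 293 / 1000 + 207 / 250 * r) (C := 317 / 1000 + 13 / 25 * r) (E := 3247 / 10000 + 361 / 500 * r) hx hy hy1 hr0' hr1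
      (by linarith) (by nlinarith [mul_nonneg (sub_nonneg.mpr h2.le) (sub_nonneg.mpr h3)]) (by linarith)
      (by nlinarith [mul_nonneg (sub_nonneg.mpr h2.le) (sub_nonneg.mpr h3), mul_nonneg (mul_nonneg (sub_nonneg.mpr h2.le) (sub_nonneg.mpr h3)) hr0'])
      (he2.trans (mul_le_mul_of_nonneg_right hE hσ0)) hb
      (fun h => first4_poly_3 hx h2.le h3 h hy hy1) (fun h => first4_cond_3 hx h2.le h3 h hy hy1)
  · have hE : 3 * r / (1 + r) ^ 2 ≤ 6299 / 10000 + 7 / 50 * r := by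
      rw [div_le_iff₀ (by positivity)]
      nlinarith [sq_nonneg (r - 3 / 4), mul_nonneg (sq_nonneg (r - 3 / 4)) hr0', sq_nonneg (r - 7 / 10)]
    exact first_cell (S := 829 / 2000 + 117 / 200 * r) (C := 179 / 400 + 259 / 1000 * r) (E := 6299 / 10000 + 7 / 50 * r) hx hy hy1 hr0' hr1
      (by linarith) (by nlinarith [mul_nonneg (sub_nonneg.mpr h3.le) (sub_nonneg.mpr hr1)]) (by linarith)
      (by nlinarith [mul_nonneg (sub_nonneg.mpr h3.le) (sub_nonneg.mpr hr1), mul_nonneg (mul_nonneg (sub_nonneg.mpr h3.le) (sub_nonneg.mpr hr1)) hr0'])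
      (he2.trans (mul_le_mul_of_nonneg_right hE hσ0)) hb
      (fun h => first4_poly_4 hx h3.le hr1 h hy hy1) (fun h => first4_cond_4 hx h3.le hr1 h hy hy1)

set_option maxHeartbeats 800000 in
/-- **THE FREE MIDDLE STEP.**  From `0 ≤ λ ≤ H₁(y)` (`y ∈ [0, 71∕100]` the predecessor's young pressure), ANY ratio `r ∈ ]0,1]`, load `x ≥ 0` under the crude line:
the condition `x(2rλ + 3∕4) < 1` and the landing `λr(1 + x∕4) + x(1 + 2rλ) ≤ H₂(x + √r·y)(1 − x(3∕4 + 2rλ))`, `H₂(Z) = (13∕10)Z∕(1 − (23∕20)Z)`. [folklore] -/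
theorem middle_step_free {x y r lam : ℝ} (hx : 0 ≤ x) (hy : 0 ≤ y) (hy1 : y ≤ 71 / 100) (hr0 : 0 < r) (hr1 : r ≤ 1)
    (hlam : lam ≤ 11 / 10 * y / (1 - 9 / 10 * y))
    (hb : x * Real.sqrt (1 / 2) + y * Real.sqrt (r / (1 + r)) ≤ 1 / 2) :
    x * (2 * r * lam + 3 / 4) < 1 ∧
    lam * r * (1 + x / 4) + x * (1 + 2 * r * lam) ≤
      13 / 10 * (x + Real.sqrt r * y) / (1 - 23 / 20 * (x + Real.sqrt r * y)) * (1 - x * (3 / 4 + 2 * r * lam)) := by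
  have hr0' := hr0.le
  rcases le_or_gt r (1 / 16) with h1 | h1
  · exact mid_cell (S := 0 + 4 * r) (C := 0 + 97 / 25 * r) hx hy hy1 hr0' hr1
      (by linarith) (by nlinarith) (by linarith) (by nlinarith [mul_nonneg hr0' (sub_nonneg.mpr h1)]) hlam hb
      (fun h => mid4_poly_1 hx hr0' h1 h hy hy1) (fun h => mid4_cond_1 hx hr0' h1 h hy hy1)
  rcases le_or_gt r (1 / 4) with h2 | h2
  · exact mid_cell (S := 2667 / 16000 + 1333 / 1000 * r) (C := 2781 / 16000 + 1091 / 1000 * r) hx hy hy1 hr0' hr1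
      (by linarith) (by nlinarith [mul_nonneg (sub_nonneg.mpr h1.le) (sub_nonneg.mpr h2)]) (by linarith)
      (by nlinarith [mul_nonneg (sub_nonneg.mpr h1.le) (sub_nonneg.mpr h2), mul_nonneg (mul_nonneg (sub_nonneg.mpr h1.le) (sub_nonneg.mpr h2)) hr0'])
      hlam hb
      (fun h => mid4_poly_2 hx h1.le h2 h hy hy1) (fun h => mid4_cond_2 hx h1.le h2 h hy hy1)
  rcases le_or_gt r (1 / 2) with h3 | h3
  · exact mid_cell (S := 293 / 1000 + 207 / 250 * r) (C := 317 / 1000 + 13 / 25 * r) hx hy hy1 hr0' hr1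
      (by linarith) (by nlinarith [mul_nonneg (sub_nonneg.mpr h2.le) (sub_nonneg.mpr h3)]) (by linarith)
      (by nlinarith [mul_nonneg (sub_nonneg.mpr h2.le) (sub_nonneg.mpr h3), mul_nonneg (mul_nonneg (sub_nonneg.mpr h2.le) (sub_nonneg.mpr h3)) hr0'])
      hlam hb
      (fun h => mid4_poly_3 hx h2.le h3 h hy hy1) (fun h => mid4_cond_3 hx h2.le h3 h hy hy1)
  rcases le_or_gt r (3 / 4) with h4 | h4
  · refine mid_cell (S := 779 / 2000 + 127 / 200 * r) (C := 169 / 400 + 309 / 1000 * r) hx hy hy1 hr0' hr1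
      (by linarith) (by nlinarith [mul_nonneg (sub_nonneg.mpr h3.le) (sub_nonneg.mpr h4)]) (by linarith)
      (by nlinarith [mul_nonneg (sub_nonneg.mpr h3.le) (sub_nonneg.mpr h4), mul_nonneg (mul_nonneg (sub_nonneg.mpr h3.le) (sub_nonneg.mpr h4)) hr0'])
      hlam hb (fun h => ?_) (fun h => mid4_cond_4 hx h3.le h4 h hy hy1)
    rcases le_or_gt y (7 / 20) with hy' | hy'
    · exact mid4_poly_4a hx h3.le h4 h hy hy'
    · exact mid4_poly_4b hx h3.le h4 h hy'.le hy1
  · refine mid_cell (S := 1859 / 4000 + 107 / 200 * r) (C := 1989 / 4000 + 209 / 1000 * r) hx hy hy1 hr0' hr1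
      (by linarith) (by nlinarith [mul_nonneg (sub_nonneg.mpr h4.le) (sub_nonneg.mpr hr1)]) (by linarith)
      (by nlinarith [mul_nonneg (sub_nonneg.mpr h4.le) (sub_nonneg.mpr hr1), mul_nonneg (mul_nonneg (sub_nonneg.mpr h4.le) (sub_nonneg.mpr hr1)) hr0'])
      hlam hb (fun h => ?_) (fun h => mid4_cond_5 hx h4.le hr1 h hy hy1)
    rcases le_or_gt y (7 / 20) with hy' | hy'
    · exact mid4_poly_5a hx h4.le hr1 h hy hy'
    · exact mid4_poly_5b hx h4.le hr1 h hy'.le hy1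

/-- **THE FREE LAST STEP FROM `H₂`.**  From `λ ≤ H₂(y)` (`y ∈ [0, 71∕100]`), ANY ratio `r ∈ ]0,1]`, load `x ≥ 0` under the crude line: the condition
`x(3∕4 + 2rλ) < 1`. [folklore] -/
theorem last_step_from_H2 {x y r lam : ℝ} (hx : 0 ≤ x) (hy : 0 ≤ y) (hy1 : y ≤ 71 / 100) (hr0 : 0 < r) (hr1 : r ≤ 1)
    (hlam : lam ≤ 13 / 10 * y / (1 - 23 / 20 * y))
    (hb : x * Real.sqrt (1 / 2) + y * Real.sqrt (r / (1 + r)) ≤ 1 / 2) : x * (3 / 4 + 2 * r * lam) < 1 := by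
  have hr0' := hr0.le
  rcases le_or_gt r (1 / 16) with h1 | h1
  · exact last_cell (C := 0 + 97 / 25 * r) hx hy hy1 hr0' (by linarith) (by nlinarith [mul_nonneg hr0' (sub_nonneg.mpr h1)]) hlam hb
      (fun h => last4_cond_1 hx hr0' h1 h hy hy1)
  rcases le_or_gt r (1 / 4) with h2 | h2
  · exact last_cell (C := 2781 / 16000 + 1091 / 1000 * r) hx hy hy1 hr0' (by linarith)
      (by nlinarith [mul_nonneg (sub_nonneg.mpr h1.le) (sub_nonneg.mpr h2), mul_nonneg (mul_nonneg (sub_nonneg.mpr h1.le) (sub_nonneg.mpr h2)) hr0'])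
      hlam hb (fun h => last4_cond_2 hx h1.le h2 h hy hy1)
  rcases le_or_gt r (1 / 2) with h3 | h3
  · exact last_cell (C := 317 / 1000 + 13 / 25 * r) hx hy hy1 hr0' (by linarith)
      (by nlinarith [mul_nonneg (sub_nonneg.mpr h2.le) (sub_nonneg.mpr h3), mul_nonneg (mul_nonneg (sub_nonneg.mpr h2.le) (sub_nonneg.mpr h3)) hr0'])
      hlam hb (fun h => last4_cond_3 hx h2.le h3 h hy hy1)
  rcases le_or_gt r (3 / 4) with h4 | h4
  · exact last_cell (C := 169 / 400 + 309 / 1000 * r) hx hy hy1 hr0' (by linarith)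
      (by nlinarith [mul_nonneg (sub_nonneg.mpr h3.le) (sub_nonneg.mpr h4), mul_nonneg (mul_nonneg (sub_nonneg.mpr h3.le) (sub_nonneg.mpr h4)) hr0'])
      hlam hb (fun h => last4_cond_4 hx h3.le h4 h hy hy1)
  · exact last_cell (C := 1989 / 4000 + 209 / 1000 * r) hx hy hy1 hr0' (by linarith)
      (by nlinarith [mul_nonneg (sub_nonneg.mpr h4.le) (sub_nonneg.mpr hr1), mul_nonneg (mul_nonneg (sub_nonneg.mpr h4.le) (sub_nonneg.mpr hr1)) hr0'])
      hlam hb (fun h => last4_cond_5 hx h4.le hr1 h hy hy1)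

end Summit.QuantumFields.BalabanUV.Beta.EriceRemainderEnclosureHistoryAutonomyComparisonFourAgesSteps

end
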